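import Summits.QuantumFields.BalabanUV.Beta.DshAn1

/-!
# `DshAn1Spread` — an1's TYPED symmetrised border shift `Dsh`, part 2∕3: §5 (Dspr) (`cDsh`, `abs_Dsh_le`, the finite window, `decays_Dsh`, `spr_Dsh`) and §6 the (0.4)
# packed first-order kernel `linSym04At` with the REDUCTION `hVd_iff` of (V-d) to the (0.4) stencil Ward law (S-V)⁰⁴ of `tabs.V` alone

W-supplier an1 gen 38 (`HOME/b2b-balaban-beta-an1-g38/sym/DshAn1.lean` fc0da04a7a2642d2, memo `sym/DSH-TYPED-an1-v1.md` 5c5b0665c0a34160); couriered by the row-D1 owner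
an2 gen 28 (split at the 400-line cap; section bytes verbatim; see `DshAn1` for the full docstring).  [folklore] finite sums over OUR objects; data defs `cDsh`,
`lin04KerAt`, `linSym04At` ([our objects — candidates asserting nothing]).  HONEST: discharges no TABLE letter; (Dspr) becomes a theorem and (V-d) a Ward law of
`tabs.V`; root-level classes 0∕5; tables 0∕5; NOT D1, NOT BetaPertH, NOT continuum, NOT Clay.  HONEST DEPENDENCY: continuum YM on T⁴ ⇐ BetaPertH ∧ nine spine
estimates (0/9 proved); BetaPertH ⇐ (D1) ∧ (D4) ∧ CAP+tail; G-an2-4 gates asym, D1 and NE2/3/4.  No statement of Bałaban's papers, no `[cite:]`, no `Prop` fact.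
-/

noncomputable section

open Finset Matrix
open scoped BigOperators Nat
open Literature.Probability.LatticeModels (Torus.proj)
open Literature.MathematicalPhysics.QuantumFieldTheory
open Literature.MathematicalPhysics.QuantumFieldTheory.Balaban1983to89
open Literature.MathematicalPhysics.QuantumFieldTheory.Balaban1983to89.Beta
open B12Sec2to5 (l1 l1_nonneg)
open ExpKernelCalculus (MKer Decays comp)
open AffineAveraging (Form0 Form1 Site unitVec unitVec_apply dz box toSite contourSum)
open AffineReproduction (contourSumAdj)
open AveragingContours (blk shift off off_mem_box blk_add_off blk_block)
open AveragingContoursRooted (ctr ctrOff ctrOff_mem_box)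
open AxialProjector (zsmul_blk_le lt_zsmul_blk_add blk_add_zsmul)
open KKTFluctuationKernel (delta1 delta1_apply)
open LatticeForm (quo)
open OneStepResolventKernel (Fib quo_zsmul eq_zsmul_quo_of_proj proj_zsmul)
open Summit.QuantumFields.BalabanUV.Beta.TameKernelCalculus
open Summit.QuantumFields.BalabanUV.Beta.AxialDressingRooted (cube mem_cube l1_le_of_mem_cube one_le_of_neZero)
open Summit.QuantumFields.BalabanUV.Beta.SymmetrisedAxialPotential
open Summit.QuantumFields.BalabanUV.Beta.SymmetrisedAxialGauge
open Summit.QuantumFields.BalabanUV.Beta.SymmetrisedDressingMatrix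
open Summit.QuantumFields.BalabanUV.Beta.KernelOrthoProjector
open Summit.QuantumFields.BalabanUV.Beta.SymSliceBlockMatrix
open Summit.QuantumFields.BalabanUV.Beta.SymSliceProjectorKernel
open Summit.QuantumFields.BalabanUV.Beta.SymSliceProjectorRules (comp_symEc_apply_inr comp_symEc_apply_inl_of_not_int comp_symEc_apply_inl_of_int)
open Summit.QuantumFields.BalabanUV.Beta.SymSliceProjectorFixed (isIntBond_of_blk_add_unitVec symTreeGaugeAt_bondIndR_of_not_int Gmat_mulVec_Pmat_row)
open Summit.QuantumFields.BalabanUV.Beta.SymGaugeMultiplierBlockMean (bondIndR_eq_delta1)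
open Summit.QuantumFields.BalabanUV.Beta.BorderedHessian (bhK bhK_inl_inl bhK_inl_inr bhK_inr_inl bhK_inr_inr off_eq_zero_iff_proj blk_eq_quo
  cube_mono contourSum_delta1_eq_contourSumAdj)
open Summit.QuantumFields.BalabanUV.Beta.WardLocusStencils (ffK ffK_inl_inl ffK_inl_inr ffK_inr_inl ffK_inr_inr)

namespace Summit.QuantumFields.BalabanUV.Beta.DshAn1

variable {d : ℕ} (N : ℕ)

/-! ## §5 (Dspr): `Dsh N` has bounded entries and a finite window, hence is spread -/

/-- [our object] The entry bound of `Dsh`: `2 · N^{d+1} · ((d+1)·N)`. -/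
def cDsh (d N : ℕ) : ℝ := 2 * ((N : ℝ) ^ (d + 1) * (((d : ℝ) + 1) * N))

/-- [folklore] `0 ≤ cDsh`. -/
theorem cDsh_nonneg (d N : ℕ) : 0 ≤ cDsh d N := by unfold cDsh; positivity

/-- [folklore] `|lam04 N α x Y| ≤ N^{d+1}·((d+1)·N)` (`N^{d+1}` block points, each tree gauge `≤ (d+1)!·((d+1)·N)`, weight `((d+1)!)⁻¹`). -/
theorem abs_lam04_le {N : ℕ} (hN : 1 ≤ N) (α : Fin (d + 1)) (x Y : Fin (d + 1) → ℤ) :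
    |lam04 N α x Y| ≤ (N : ℝ) ^ (d + 1) * (((d : ℝ) + 1) * N) := by
  rw [lam04, SymLamAt_eq_sum_symTreeGaugeAt, abs_mul, abs_inv, Nat.abs_cast]
  have hterm : ∀ b ∈ box (d + 1) N,
      |symTreeGaugeAt (ctr (d + 1) N) (delta1 α x) N ((N : ℤ) • Y + toSite b)| ≤ ((d + 1) ! : ℝ) * (((d : ℝ) + 1) * N) := by
    intro b _
    rw [← bondIndR_eq_delta1, show ctr (d + 1) N = toSite (ctrOff (d + 1) N) from rfl]
    have h := abs_symTreeGaugeAt_bondIndR_le hN (ctrOff_mem_box hN) α x ((N : ℤ) • Y + toSite b)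
    push_cast at h
    exact h
  have hsum := (Finset.abs_sum_le_sum_abs _ _).trans (Finset.sum_le_sum hterm)
  have hcard : (box (d + 1) N).card = N ^ (d + 1) := by
    simp [AffineAveraging.box, Fintype.card_piFinset, Finset.card_range, Finset.prod_const, Finset.card_univ, Fintype.card_fin]
  rw [Finset.sum_const, hcard, nsmul_eq_mul] at hsum
  push_cast at hsum
  have hf : (0 : ℝ) < ((d + 1) ! : ℝ) := by exact_mod_cast Nat.factorial_pos _
  calc ((d + 1) ! : ℝ)⁻¹ * |∑ b ∈ box (d + 1) N, symTreeGaugeAt (ctr (d + 1) N) (delta1 α x) N ((N : ℤ) • Y + toSite b)|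
      ≤ ((d + 1) ! : ℝ)⁻¹ * ((N : ℝ) ^ (d + 1) * (((d + 1) ! : ℝ) * (((d : ℝ) + 1) * N))) :=
        mul_le_mul_of_nonneg_left hsum (inv_nonneg.2 hf.le)
    _ = (N : ℝ) ^ (d + 1) * (((d : ℝ) + 1) * N) := by field_simp

/-- [folklore] `|dz (lam04 N α x) m Y| ≤ cDsh d N`. -/
theorem abs_dz_lam04_le {N : ℕ} (hN : 1 ≤ N) (α m : Fin (d + 1)) (x Y : Fin (d + 1) → ℤ) : |dz (lam04 N α x) m Y| ≤ cDsh d N := by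
  rw [dz, cDsh]
  have h1 := abs_lam04_le hN α x (Y + unitVec m)
  have h2 := abs_lam04_le hN α x Y
  calc |lam04 N α x (Y + unitVec m) - lam04 N α x Y| ≤ |lam04 N α x (Y + unitVec m)| + |lam04 N α x Y| := abs_sub _ _
    _ ≤ (N : ℝ) ^ (d + 1) * (((d : ℝ) + 1) * N) + (N : ℝ) ^ (d + 1) * (((d : ℝ) + 1) * N) := add_le_add h1 h2
    _ = 2 * ((N : ℝ) ^ (d + 1) * (((d : ℝ) + 1) * N)) := by ring

/-- [folklore] **ENTRY BOUND** `|Dsh N x y a b| ≤ cDsh d N`. -/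
theorem abs_Dsh_le {N : ℕ} (hN : 1 ≤ N) (x y : Fin (d + 1) → ℤ) (a b : Fib d) : |Dsh N x y a b| ≤ cDsh d N := by
  rcases a with α | m <;> rcases b with β | m'
  · rw [Dsh_inl_inl, abs_zero]; exact cDsh_nonneg d N
  · rw [Dsh_inl_inr]
    split_ifs
    · exact abs_dz_lam04_le hN α m' x _
    · rw [abs_zero]; exact cDsh_nonneg d N
  · rw [Dsh_inr_inl]
    split_ifs
    · rw [abs_neg]; exact abs_dz_lam04_le hN β m y _
    · rw [abs_zero]; exact cDsh_nonneg d N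
  · rw [Dsh_inr_inr, abs_zero]; exact cDsh_nonneg d N

/-- [folklore] On its own block `lam04` of an interior bond is the normalised column sum; elsewhere `0`. -/
theorem lam04_eq_of_int {N : ℕ} (hN : 1 ≤ N) {α : Fin (d + 1)} {x : Fin (d + 1) → ℤ} (hα : IsIntBond N α x) (Y : Fin (d + 1) → ℤ) :
    lam04 N α x Y = if Y = blk N x then ((d + 1) ! : ℝ)⁻¹ * colG N ⟨(α, off N x), hα⟩ else 0 := by
  have h := SymLamAt_delta1_block hN (blk N x) ⟨(α, off N x), hα⟩ Y
  dsimp only at h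
  rw [blk_add_off hN x] at h
  rw [lam04, h, mul_ite, mul_zero]

/-- [folklore] **(Dgrad) THE READOUT POTENTIAL IS SUPPORTED ON ONE COARSE POINT**: `lam04 N α x Y = 0` unless `Y = blk N x` — so the field–multiplier block
`Dsh N x y (inl α) (inr m) = [proj N y = 0]·(lam04 N α x (y∕N + e_m) − lam04 N α x (y∕N))` (`Dsh_inl_inr`, `dz`) is the COARSE GRADIENT, in the multiplier's
coarse variable, of a potential supported at the single coarse point `blk N x` (the structural input of an2-g28's announced E1b «(Dgrad) ⟹ (DG)»). -/
theorem lam04_eq_zero_of_ne_blk {N : ℕ} (hN : 1 ≤ N) {α : Fin (d + 1)} {x Y : Fin (d + 1) → ℤ} (hY : Y ≠ blk N x) : lam04 N α x Y = 0 := by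
  by_cases hα : IsIntBond N α x
  · rw [lam04_eq_of_int hN hα, if_neg hY]
  · rw [lam04, SymLamAt_delta1_of_not_int hN hα, mul_zero]

/-- [folklore] (Dgrad), readout form: the field–multiplier entry as a difference of the one-point potential. -/
theorem Dsh_inl_inr_eq_sub (x y : Fin (d + 1) → ℤ) (α m : Fin (d + 1)) :
    Dsh N x y (Sum.inl α) (Sum.inr m) = if Torus.proj N y = 0 then lam04 N α x (quo N y + unitVec m) - lam04 N α x (quo N y) else 0 := rfl

/-- [folklore] **SUPPORT OF THE COARSE GRADIENT**: `dz (lam04 N α x) m Y ≠ 0 ⇒ Y = blk x ∨ Y + e_m = blk x`. -/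
theorem dz_lam04_ne_zero_imp {N : ℕ} (hN : 1 ≤ N) {α m : Fin (d + 1)} {x Y : Fin (d + 1) → ℤ} (h : dz (lam04 N α x) m Y ≠ 0) :
    Y = blk N x ∨ Y + unitVec m = blk N x := by
  by_cases hα : IsIntBond N α x
  · by_contra hc
    push Not at hc
    apply h
    rw [dz, lam04_eq_of_int hN hα, lam04_eq_of_int hN hα, if_neg hc.2, if_neg hc.1, sub_self]
  · exact absurd (dz_lam04_of_not_int hN hα m Y) h

/-- [folklore] If the block of `x` is the block of `y` shifted by `e_m`, then `x − y` lies in the window of radius `2N`. -/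
theorem sub_mem_cube_of_blk_add_unitVec {N : ℕ} (hN : 1 ≤ N) {x y : Fin (d + 1) → ℤ} {m : Fin (d + 1)} (h : blk N y + unitVec m = blk N x) :
    x - y ∈ cube (d + 1) (2 * N) := by
  rw [mem_cube]
  intro i
  have a1 := zsmul_blk_le hN x i
  have a2 := lt_zsmul_blk_add hN x i
  have b1 := zsmul_blk_le hN y i
  have b2 := lt_zsmul_blk_add hN y i
  have e : ((N : ℤ) • blk N x) i = ((N : ℤ) • blk N y) i + (N : ℤ) * (if i = m then 1 else 0) := by
    rw [← h]
    simp only [Pi.smul_apply, Pi.add_apply, smul_eq_mul, unitVec_apply, mul_add]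
  rw [e] at a1 a2
  rw [Pi.sub_apply, abs_le]
  push_cast
  split_ifs at a1 a2
  · constructor <;> omega
  · constructor <;> omega

/-- [folklore] The window is symmetric. -/
theorem neg_sub_mem_cube {n M : ℕ} {x y : Fin n → ℤ} (h : y - x ∈ cube n M) : x - y ∈ cube n M := by
  rw [mem_cube] at h ⊢
  intro i
  rw [Pi.sub_apply, abs_sub_comm, ← Pi.sub_apply]
  exact h i

/-- [folklore] **WINDOW OF THE FIELD–MULTIPLIER BLOCK**: a non-zero entry forces `x − y ∈ cube (2N)`. -/
theorem Dsh_inl_inr_ne_zero_window {N : ℕ} (hN : 1 ≤ N) {x y : Fin (d + 1) → ℤ} {α m : Fin (d + 1)}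
    (h : Dsh N x y (Sum.inl α) (Sum.inr m) ≠ 0) : x - y ∈ cube (d + 1) (2 * N) := by
  rw [Dsh_inl_inr] at h
  split_ifs at h with hy
  · have hyq : blk N y = quo N y := by
      rw [blk_eq_quo]
    rcases dz_lam04_ne_zero_imp hN h with h1 | h1
    · exact cube_mono (by omega) (sub_mem_cube_of_blk_eq hN (hyq.trans h1))
    · exact sub_mem_cube_of_blk_add_unitVec hN (by rw [hyq]; exact h1)
  · exact absurd rfl h

/-- [folklore] **WINDOW**: `Dsh N x y a b ≠ 0 ⇒ x − y ∈ cube (d+1) (2N)`. -/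
theorem Dsh_ne_zero_window {N : ℕ} (hN : 1 ≤ N) {x y : Fin (d + 1) → ℤ} {a b : Fib d} (h : Dsh N x y a b ≠ 0) :
    x - y ∈ cube (d + 1) (2 * N) := by
  rcases a with α | m <;> rcases b with β | m'
  · exact absurd (Dsh_inl_inl N x y α β) h
  · exact Dsh_inl_inr_ne_zero_window hN h
  · rw [Dsh_inr_inl_eq_neg, neg_ne_zero] at h
    exact neg_sub_mem_cube (Dsh_inl_inr_ne_zero_window hN h)
  · exact absurd (Dsh_inr_inr N x y m m') h

/-- [folklore] **`Dsh N` DECAYS AT EVERY RATE** (finite window `2N(d+1)` in `ℓ¹`, bounded entries). -/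
theorem decays_Dsh {N : ℕ} (hN : 1 ≤ N) {δ : ℝ} (hδ : 0 ≤ δ) :
    Decays (Dsh (d := d) N) (cDsh d N * Real.exp (δ * (((d : ℝ) + 1) * (2 * N)))) δ := by
  intro x y a b
  by_cases h0 : Dsh N x y a b = 0
  · rw [h0, abs_zero]
    exact mul_nonneg (mul_nonneg (cDsh_nonneg d N) (Real.exp_pos _).le) (Real.exp_pos _).le
  · have hxy := Dsh_ne_zero_window hN h0
    have hl : l1 (x - y) ≤ ((d : ℝ) + 1) * (2 * N) := by
      have := l1_le_of_mem_cube hxy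
      push_cast at this
      linarith
    calc |Dsh N x y a b| ≤ cDsh d N * 1 := by rw [mul_one]; exact abs_Dsh_le hN x y a b
      _ ≤ cDsh d N * (Real.exp (δ * (((d : ℝ) + 1) * (2 * N))) * Real.exp (-δ * l1 (x - y))) := by
          refine mul_le_mul_of_nonneg_left ?_ (cDsh_nonneg d N)
          rw [← Real.exp_add]
          exact Real.one_le_exp (by nlinarith)
      _ = cDsh d N * Real.exp (δ * (((d : ℝ) + 1) * (2 * N))) * Real.exp (-δ * l1 (x - y)) := by ring

/-- [folklore] **(Dspr) `Dsh N` IS SPREAD** (`N ≥ 1`) — the hypothesis `hD : Spr Dsh` of the END as a THEOREM for an1's `Dsh`. -/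
theorem spr_Dsh {N : ℕ} (hN : 1 ≤ N) : Spr (Dsh (d := d) N) :=
  ⟨_, 1, one_pos, decays_Dsh hN zero_le_one⟩

/-! ## §6 The (0.4) packed first-order kernel `linSym04At` and the REDUCTION OF (V-d) to the (0.4) stencil Ward law of `tabs.V` alone -/

/-- [our object] The normalised (0.4) first-order kernel of the fine bond `f = (α, x)` on the coarse bond `(μ, B)`:
`((L^{d+1})⁻¹ · ((d+1)!)⁻¹ · symLinAvgAt ρ (δ_f) L μ B` (twin of an2∕an1's comb `linKerAt ρ L μ B f`). -/
def lin04KerAt (ρ : Fin (d + 1) → ℤ) (L : ℕ) (μ : Fin (d + 1)) (B : Fin (d + 1) → ℤ) (f : Fin (d + 1) × (Fin (d + 1) → ℤ)) : ℝ :=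
  ((L : ℝ) ^ (d + 1))⁻¹ * (((d + 1) ! : ℝ)⁻¹ * symLinAvgAt ρ (delta1 f.1 f.2) L μ B)

/-- [our object] **THE (0.4) PACKED FIRST-ORDER KERNEL** (twin of `AveragingWardRootedStencils.linSymAt ρ L` with `linKerAt ↦ lin04KerAt`). -/
def linSym04At (ρ : Fin (d + 1) → ℤ) (L : ℕ) : MKer (d + 1) (Fib d) := fun x z a b =>
  match a, b with
  | Sum.inl α, Sum.inr μ => if off L z = 0 then lin04KerAt ρ L μ (blk L z) (α, x) else 0
  | Sum.inr μ, Sum.inl α => if off L x = 0 then lin04KerAt ρ L μ (blk L x) (α, z) else 0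
  | Sum.inl _, Sum.inl _ => 0
  | Sum.inr _, Sum.inr _ => 0

section Lin04
variable (ρ : Fin (d + 1) → ℤ) (L : ℕ)

/-- [folklore] Field–multiplier entry of `linSym04At`. -/
@[simp] theorem linSym04At_inl_inr (x z : Fin (d + 1) → ℤ) (α μ : Fin (d + 1)) :
    linSym04At ρ L x z (Sum.inl α) (Sum.inr μ) = if off L z = 0 then lin04KerAt ρ L μ (blk L z) (α, x) else 0 := rfl
/-- [folklore] Multiplier–field entry of `linSym04At`. -/
@[simp] theorem linSym04At_inr_inl (x z : Fin (d + 1) → ℤ) (μ α : Fin (d + 1)) :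
    linSym04At ρ L x z (Sum.inr μ) (Sum.inl α) = if off L x = 0 then lin04KerAt ρ L μ (blk L x) (α, z) else 0 := rfl
/-- [folklore] The field–field block of `linSym04At` vanishes. -/
@[simp] theorem linSym04At_inl_inl (x z : Fin (d + 1) → ℤ) (α α' : Fin (d + 1)) : linSym04At ρ L x z (Sum.inl α) (Sum.inl α') = 0 := rfl
/-- [folklore] The multiplier–multiplier block of `linSym04At` vanishes. -/
@[simp] theorem linSym04At_inr_inr (x z : Fin (d + 1) → ℤ) (μ μ' : Fin (d + 1)) : linSym04At ρ L x z (Sum.inr μ) (Sum.inr μ') = 0 := rfl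

/-- [folklore] `linSym04At ρ` is symmetric. -/
theorem linSym04At_symm (x z : Fin (d + 1) → ℤ) (a b : Fib d) : linSym04At ρ L x z a b = linSym04At ρ L z x b a := by
  rcases a with α | μ <;> rcases b with α' | μ' <;> rfl
end Lin04

open StepJetData (mfNeg mfNeg_inl_inl mfNeg_inl_inr mfNeg_inr_inl mfNeg_inr_inr) in
/-- [folklore] **THE BORDER DICTIONARY OF THE SHIFTED STRAIGHT SPREAD, KERNEL FORM** (twin of an2's `WardLocusStencils.bhKAt_eq_ffK_sub_smul_mfNeg_linSymAt`):
`bhK L + Dsh L = ffK (bhK L) − L^{d+1} • mfNeg (linSym04At ρ_c L)`. -/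
theorem bhK_add_Dsh_eq_ffK_sub_smul_mfNeg_linSym04At (L : ℕ) [NeZero L] :
    bhK L + Dsh (d := d) L = ffK (bhK (d := d) L) - ((L : ℝ) ^ (d + 1)) • mfNeg (linSym04At (ctr (d + 1) L) L) := by
  have hL : ((L : ℝ) ^ (d + 1)) ≠ 0 := pow_ne_zero _ (Nat.cast_ne_zero.2 (NeZero.ne L))
  funext x z a b
  simp only [Pi.sub_apply, Pi.smul_apply, smul_eq_mul]
  rcases a with κ | κ <;> rcases b with l | l
  · rw [Pi.add_apply, Pi.add_apply, Pi.add_apply, Pi.add_apply, Dsh_inl_inl, add_zero, ffK_inl_inl, mfNeg_inl_inl, linSym04At_inl_inl]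
    ring
  · rw [bhK_add_Dsh_inl_inr, ffK_inl_inr, mfNeg_inl_inr, linSym04At_inl_inr]
    by_cases hz : off L z = 0
    · have hz' : Torus.proj L z = 0 := (off_eq_zero_iff_proj z).1 hz
      rw [if_pos hz', if_pos hz, lin04KerAt, blk_eq_quo]
      field_simp
      ring
    · have hz' : ¬ Torus.proj L z = 0 := fun h => hz ((off_eq_zero_iff_proj z).2 h)
      rw [if_neg hz', if_neg hz]; ring
  · rw [bhK_add_Dsh_inr_inl, ffK_inr_inl, mfNeg_inr_inl, linSym04At_inr_inl]
    by_cases hx : off L x = 0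
    · have hx' : Torus.proj L x = 0 := (off_eq_zero_iff_proj x).1 hx
      rw [if_pos hx', if_pos hx, lin04KerAt, blk_eq_quo]
      field_simp
      ring
    · have hx' : ¬ Torus.proj L x = 0 := fun h => hx ((off_eq_zero_iff_proj x).2 h)
      rw [if_neg hx', if_neg hx]; ring
  · rw [Pi.add_apply, Pi.add_apply, Pi.add_apply, Pi.add_apply, bhK_inr_inr, Dsh_inr_inr, ffK_inr_inr, mfNeg_inr_inr, linSym04At_inr_inr]
    ring

open StepJetData (mfNeg) in
open Summit.QuantumFields.BalabanUV.Beta.ChartConjugation (conjV) in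
open Summit.QuantumFields.BalabanUV.Beta.BorderedHessian (diagK conjV_diagK_apply) in
open Summit.QuantumFields.BalabanUV.Beta.AveragingWardRootedStencils (legInd) in
/-- [folklore] **THE REDUCTION OF THE BORDER LETTER (V-d)**: against the TYPED shift, the END's letter
`∀ u, conjV (bhK L + Dsh L) (D_u) = conjV (ffK (bhK L)) (D_u) − L^{d+1} • W u` (`D_u = diagK (legInd ρ_c u)`, `W u = divV tabs.V u`) is EQUIVALENT to the
(0.4) STENCIL WARD LAW `∀ u, W u = conjV (mfNeg (linSym04At ρ_c L)) (D_u)` — LITERALLY the (0.4)-twin of an2's theorem `AveragingWardRootedStencils.divV_vhSAt_eq_conjV`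
for the comb table `vhSAt ρ`; `bhK`, `Dsh`, `ffK` have left the letter (entrywise: `conjV M (diagK g) = M · (g(col) − g(row))`). -/
theorem hVd_iff (L : ℕ) [NeZero L] (W : (Fin (d + 1) → ℤ) → MKer (d + 1) (Fib d)) :
    (∀ u : Fin (d + 1) → ℤ, conjV (bhK L + Dsh (d := d) L) (diagK (legInd (ctr (d + 1) L) u))
        = conjV (ffK (bhK (d := d) L)) (diagK (legInd (ctr (d + 1) L) u)) - ((L : ℝ) ^ (d + 1)) • W u)
      ↔ ∀ u : Fin (d + 1) → ℤ, W u = conjV (mfNeg (linSym04At (ctr (d + 1) L) L)) (diagK (legInd (ctr (d + 1) L) u)) := by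
  have hL : ((L : ℝ) ^ (d + 1)) ≠ 0 := pow_ne_zero _ (Nat.cast_ne_zero.2 (NeZero.ne L))
  rw [bhK_add_Dsh_eq_ffK_sub_smul_mfNeg_linSym04At]
  refine forall_congr' fun u => ⟨fun h => ?_, fun h => ?_⟩
  · funext x z a b
    have e := congrFun (congrFun (congrFun (congrFun h x) z) a) b
    simp only [Pi.sub_apply, Pi.smul_apply, smul_eq_mul, conjV_diagK_apply] at e
    rw [conjV_diagK_apply]
    have h2 : (L : ℝ) ^ (d + 1) * W u x z a b = (L : ℝ) ^ (d + 1)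
        * (mfNeg (linSym04At (ctr (d + 1) L) L) x z a b * (legInd (ctr (d + 1) L) u z b - legInd (ctr (d + 1) L) u x a)) := by
      linear_combination e
    exact mul_left_cancel₀ hL h2
  · funext x z a b
    simp only [Pi.sub_apply, Pi.smul_apply, smul_eq_mul, conjV_diagK_apply, h]
    ring

end Summit.QuantumFields.BalabanUV.Beta.DshAn1

end
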